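import Summits.FinalStateConjecture.FinalStateConjecture.Theses.ExactKerrEnds
import Summits.FinalStateConjecture.FinalStateConjecture.Theorems.SwallowTheDatumParametricKerrBurialLine
import Literature.Geometry.Lorentzian.ExactKerrEnd
import Literature.Geometry.Lorentzian.TameGenericity
import Literature.Geometry.Lorentzian.AFEndRestrict

/-!
# Line `matched-kerr-solution-map` — crux `ExactKerrEnds.TameEscapeToKerrEnds` (stmt-FinalStateConjecture-18522)

Strategist skeleton (planner-cstrat-stmt-FinalStateConjecture-18522-b1-0, 2026-08-17).  Four registered stubs and the
kernel-checked composition `TameEscapeToKerrEnds_of` concluding the crux BY NAME.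

* `stub_matchedKerrGluingFamily` (S1, the analytic core, chart-of-the-end level): CHARGE-MATCHED exterior Kerr gluing
  with a smooth solution map — Mao–Oh–Tao arXiv:2308.13031 Thm 1.3 ("gluing up to linear obstructions at unit
  scale", printed with a LIPSCHITZ solution map `(g̊,k̊) ↦ (g,k,Q)` and persistence of regularity) run along the smooth
  input curve `R ↦ d(R·)|_{A₁}` with the Kerr family of their Lemma 5.5 (proof of their Thm 1.6 = Corvino–Schoen 2006
  Thm 4 / Chruściel–Delay 2003 Thm 8.1): a radius-indexed family `G R` of admissible data, `= d` off `e.far R`,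
  exactly a spacelike Kerr leaf beyond chart radius `4R`, Dafermos–Rodnianski flat on the SAME end with masses
  `m R → M`, jointly smooth in `(R, x)`, and `e.wDist (G R) d → 0`.  Needs `M > 0` (`|E| > |P|`).
* `stub_nonposMassKerrEnded` (S2, the rigidity branch): an admissible datum whose DR mass parameter on a sole end is
  `≤ 0` is already Kerr-ended (`M < 0` is excluded by the spacetime positive mass theorem, `M = 0` forces a
  hypersurface of Minkowski space = an exact `η`-leaf, `Kerr.bilin 0 a = η`).
* `stub_chartKerrEnd` (S3a, bookkeeping): chart-level exact Kerr beyond `ρ` on a sole end ⇒ `HasExactKerrEnd`.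
* `stub_tameJunction` (S3b, bookkeeping = the tame upgrade of the landed `junction`/`stub_breathing` of the sibling
  crux `SwallowTheDatum.ParametricKerrBurial`): receding Kerr-ended surgery family + breathing ⇒ a TAME, injective,
  immersed admissible curve through `d` whose members off `0` are Kerr-ended.

Nothing here is asserted beyond the stubs; `TameEscapeToKerrEnds_of` is sorry-free.
-/

set_option linter.dupNamespace false

noncomputable section

namespace Summit.FinalStateConjecture.FinalStateConjecture.Cruxes.TameEscapeToKerrEnds.MatchedKerrSolutionMap

open scoped Manifold ContDiff Topology
open Set Filter Function TopologicalSpace Literature.Geometry.Lorentzian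
open Summit.FinalStateConjecture.FinalStateConjecture.Theorems.SwallowTheDatum.ParametricKerrBurial
  (SmoothSectionsOn AgreeAt)

/-! ## §0 Vocabulary (one definition) -/

section Vocabulary

variable {X : Type} [TopologicalSpace X] [ChartedSpace E3 X] [IsManifold (𝓡 3) ∞ X]

/-- **Chart-level exact Kerr end beyond radius `ρ`.**  In the chart of the end `e`, beyond coordinate radius `ρ`, the
datum `D` is an exact spacelike leaf of a Kerr chart: there are Kerr parameters `M ≥ 0`, `a`, a chart floor `r₀`, an
INJECTIVE spacelike immersion `ψ : {ρ < ‖y‖} → Kerr.region a r₀` (ingoing Kerr–Schild chart) with future unit normal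
`ν`, such that the chart components of `D` are the induced data: `hCoeff e D y (v, w) = g_{M,a}(dψ v, dψ w)` and
`kCoeff e D y (v, w) = K_ν(ψ)(v, w)` for `ρ < ‖y‖` — the clauses of `InitialDataSet.IsExactKerrEndAlong` read in
the chart `φ = e.dataChartExt` (Corvino–Schoen 2006 Thm 4: "agrees with a member of the Kerr slice family on
`E_{2R}`"). [cite: CorvinoSchoen2006, Thm. 4] -/
def IsChartExactKerrBeyond [Kerr.Facts] (e : AFEnd X) (D : InitialDataSet (𝓡 3) X) (ρ : ℝ) : Prop :=
  ∃ (M a r₀ : ℝ) (hM : 0 ≤ M) (ψ : exteriorRegion ρ → Kerr.region a r₀) (ν : NormalField 𝓘(ℝ, E4) ψ),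
    Injective ψ ∧
    (Kerr.smoothMetric M a r₀).IsSpacelikeImmersion 𝓘(ℝ, E3) ψ ∧
    (Kerr.smoothMetric M a r₀).IsFutureUnitNormal 𝓘(ℝ, E3)
      ((Kerr.timeOrientation M a r₀ hM).ofLE le_top) ψ ν ∧
    (∀ (y : exteriorRegion ρ) (v w : E3),
      AFEnd.hCoeff e D (y : E3) v w =
        Kerr.bilin M a (ψ y : E4) (mfderiv 𝓘(ℝ, E3) 𝓘(ℝ, E4) ψ y v)
          (mfderiv 𝓘(ℝ, E3) 𝓘(ℝ, E4) ψ y w)) ∧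
    (∀ [(Kerr.smoothMetric M a r₀).HasLeviCivita] (y : exteriorRegion ρ) (v w : E3),
      AFEnd.kCoeff e D (y : E3) v w =
        (Kerr.smoothMetric M a r₀).secondFundamentalForm 𝓘(ℝ, E3) ψ ν y v w)

end Vocabulary

/-! ## §1 The four statements of the line (named), their registered aliases and the sorried stubs -/

/-- **S1 — matched exterior Kerr gluing with a smooth solution map (the analytic core).**  For an admissible datum
`d` on `X`, a sole end `e` on which `d` is Dafermos–Rodnianski flat with mass parameter `M > 0`: there are `R⋆ > e.R`,
a mass function `m`, continuous on `(R⋆, ∞)` with `m R → M`, and a radius-indexed family `G R` of data on `X`,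
jointly smooth in `(R, x)` on `{R⋆ < R} × X`, such that for every `R > R⋆` the member `G R` is admissible, agrees
with `d` (as sections) off the far region `e.far R`, is DR-flat on the SAME end `e` with mass `m R`, and is an exact
spacelike Kerr leaf beyond chart radius `4R` (`IsChartExactKerrBeyond`); and `e.wDist (G R) d → 0` as `R → ∞`.
Engine: Mao–Oh–Tao arXiv:2308.13031 Thm 1.3 + Lemma 5.5 (proof of Thm 1.6), CHARGE-MATCHED (the selected Kerr has
`E(Q) = E_in(R) + O(M²/R)`, `J, C` matched on the annulus — obstruction-free energy-adding gluing is excluded by the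
`r¹` weight of `wDist`, MOT Rem 1.8); smooth dependence on `R` = the Picard fixed point of MOT §3 along the smooth
curve `R ↦ d(R·)`; at unit scale in/out differ by `o(1/R)` in `C² × C¹`, so the corrector is `o(1/R)` and the
weighted distance `o(1)`.  UNPRINTED ATOMS: `C^∞` (not Lipschitz) dependence; `C²`-sup (not `H²`) smallness of the
corrector for data controlled only in the sup-norm DR class (endpoint Schauder).
[cite: MaoOhTao2023, Thm. 1.3, Lemma 5.5, Thm. 1.6] [cite: CorvinoSchoen2006, Thm. 4] [cite: ChruscielDelay2003, Thm. 8.1] -/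
def MatchedKerrGluingFamily : Prop :=
    ∀ (X : Type) [TopologicalSpace X] [ChartedSpace E3 X] [IsManifold (𝓡 3) ∞ X] [T2Space X]
      [SecondCountableTopology X] [ConnectedSpace X], ∀ [Kerr.Facts],
      ∀ d ∈ admissibleVacuumData X, ∀ (e : AFEnd X) (M : ℝ), e.IsSoleEnd → 0 < M →
        e.IsStronglyAsymptoticallyFlatDR d M →
        ∃ (Rstar : ℝ) (m : ℝ → ℝ) (G : ℝ → InitialDataSet (𝓡 3) X),
          e.R < Rstar ∧ ContinuousOn m (Ioi Rstar) ∧ Tendsto m atTop (𝓝 M) ∧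
          SmoothSectionsOn 𝓘(ℝ, ℝ) G {p : ℝ × X | Rstar < p.1} ∧
          (∀ R : ℝ, Rstar < R →
            G R ∈ admissibleVacuumData X ∧ (∀ x ∉ e.far R, AgreeAt (G R) d x) ∧
              e.IsStronglyAsymptoticallyFlatDR (G R) (m R) ∧ IsChartExactKerrBeyond e (G R) (4 * R)) ∧
          Tendsto (fun R ↦ e.wDist (G R) d) atTop (𝓝 0)

/-- **S2 — non-positive mass parameter forces an exact Kerr (indeed Minkowski) end.**  If an admissible datum `d` is
DR-flat with mass parameter `M ≤ 0` on a sole end, then `d` is Kerr-ended.  `M < 0` contradicts the spacetime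
positive mass theorem (`E ≥ |P|`, the DR mass parameter IS the ADM energy and `P = 0` in the DR class); `M = 0` is
the equality case `E = |P| = 0`, whose rigidity makes `(X, h, k)` a spacelike hypersurface of Minkowski space, i.e.
an exact leaf of `Kerr.bilin 0 a = η` off a compact set (the leaf avoiding the excluded axis `{x⃗ = 0}` of
`Kerr.region`).  [cite: EichmairHuangLeeSchoen2016, Thm. 1] [cite: HuangLee2020, Thm. 1.1] [cite: BeigChrusciel1996, Thm. 1.1] -/
def NonposMassKerrEnded : Prop :=
    ∀ (X : Type) [TopologicalSpace X] [ChartedSpace E3 X] [IsManifold (𝓡 3) ∞ X] [T2Space X]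
      [SecondCountableTopology X] [ConnectedSpace X],
      ∀ d ∈ admissibleVacuumData X, ∀ (e : AFEnd X) (M : ℝ), e.IsSoleEnd → M ≤ 0 →
        e.IsStronglyAsymptoticallyFlatDR d M → d.HasExactKerrEnd

/-- **S3a — chart-level exact Kerr beyond `ρ` on a sole end is an exact Kerr end.**  Take `K := (e.far ρ)ᶜ` (compact,
`IsSoleEnd.isCompact_compl_far`), `U := exteriorRegion ρ`, `φ := e.dataChartExt ∘ (↑)` (smooth open embedding with
`Kᶜ = e.far ρ ⊆ range φ`: `AFEndChartEmbedding`), the given leaf `ψ` and normal `ν`; the metric / `k` clauses are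
`hCoeff_apply_eq_dataChartExt`, `kCoeff_apply_eq_dataChartExt` and the chain rule along `(↑)`. [folklore] -/
def ChartKerrEnd : Prop :=
    ∀ (X : Type) [TopologicalSpace X] [ChartedSpace E3 X] [IsManifold (𝓡 3) ∞ X] [T2Space X]
      [SecondCountableTopology X] [ConnectedSpace X], ∀ [Kerr.Facts],
      ∀ (e : AFEnd X) (D : InitialDataSet (𝓡 3) X) (ρ : ℝ), e.IsSoleEnd → e.R ≤ ρ →
        IsChartExactKerrBeyond e D ρ → D.HasExactKerrEnd

/-- **S3b — the tame junction: receding Kerr-ended surgery + breathing ⇒ a tame injective immersed Kerr-ended curve.**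
From a radius-indexed family `G R` (`R > R⋆ > e.R`) of admissible Kerr-ended data agreeing with `d` off `e.far R`,
DR-flat on `e` with masses `m R → M` (`m` continuous), jointly smooth in `(R, x)`, with `e.wDist (G R) d → 0`:
breathe inside the shell `{e.R < ‖coord‖ < R⋆}` where every member equals `d` (`S (R, t) := breathe(σ t)^* (G R)`,
`E t := breathe(σ t)^* d`), reparametrise `F c := S (R⋆ + 1 + ‖c‖⁻², arctan(c₀)/2)`, `F 0 := d` (the landed
`junction`: smooth — at `c = 0` by local exhaustion —, injective by the marker `(1 + σ t)² h_d(x₀)(v₀,v₀)`);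
IMMERSED at `0` by the `c`-derivative of the same marker; Kerr-ended off `0` by `HasExactKerrEnd.of_eq_off_compact`
(breathing moves a compact core); admissible by naturality + `AdmissibleDataLocality`; TAME on the collared end
`e' := e.restrict R₁` with the breathing ball below `R₁ < R⋆`: there `F c = G (R c)` on `e'.U`, so
`e'.wDist (F c) d ≤ e.wDist (G (R c)) d → 0` (`wDist_restrict_eq`), and the mass function
`c ↦ m (R c)` (`M` at `0`) is continuous. [cite: Christodoulou1999, p. A24] -/
def TameJunction : Prop :=
    ∀ (X : Type) [TopologicalSpace X] [ChartedSpace E3 X] [IsManifold (𝓡 3) ∞ X] [T2Space X]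
      [SecondCountableTopology X] [ConnectedSpace X],
      ∀ (d : InitialDataSet (𝓡 3) X) (e : AFEnd X) (M Rstar : ℝ) (m : ℝ → ℝ)
        (G : ℝ → InitialDataSet (𝓡 3) X),
        d ∈ admissibleVacuumData X → e.IsSoleEnd → e.IsStronglyAsymptoticallyFlatDR d M → e.R < Rstar →
        ContinuousOn m (Ioi Rstar) → Tendsto m atTop (𝓝 M) →
        SmoothSectionsOn 𝓘(ℝ, ℝ) G {p : ℝ × X | Rstar < p.1} →
        (∀ R : ℝ, Rstar < R →
          G R ∈ admissibleVacuumData X ∧ (∀ x ∉ e.far R, AgreeAt (G R) d x) ∧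
            e.IsStronglyAsymptoticallyFlatDR (G R) (m R) ∧ (G R).HasExactKerrEnd) →
        Tendsto (fun R ↦ e.wDist (G R) d) atTop (𝓝 0) →
        ∃ (e' : AFEnd X) (F : EuclideanSpace ℝ (Fin 1) → InitialDataSet (𝓡 3) X),
          InitialDataSet.IsTameDataFamily e' 1 F ∧ InitialDataSet.IsImmersedAtZero 1 F ∧ F 0 = d ∧
            Injective F ∧ (∀ c, F c ∈ admissibleVacuumData X) ∧ ∀ c ≠ 0, (F c).HasExactKerrEnd

/-! ### Registered stub names (aliases keyed by the stub names; `TameEscapeToKerrEnds_of` takes them BY NAME) -/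

namespace Registered

/-- Alias of `MatchedKerrGluingFamily` keyed by the registered stub name. -/
abbrev stub_matchedKerrGluingFamily : Prop := MatchedKerrGluingFamily
/-- Alias of `NonposMassKerrEnded` keyed by the registered stub name. -/
abbrev stub_nonposMassKerrEnded : Prop := NonposMassKerrEnded
/-- Alias of `ChartKerrEnd` keyed by the registered stub name. -/
abbrev stub_chartKerrEnd : Prop := ChartKerrEnd
/-- Alias of `TameJunction` keyed by the registered stub name. -/
abbrev stub_tameJunction : Prop := TameJunction

end Registered

/-- STUB S1 (HARDEST; XL; the analytic core — matched exterior Kerr gluing with a smooth solution map). -/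
theorem stub_matchedKerrGluingFamily : MatchedKerrGluingFamily := by
  sorry

/-- STUB S2 (XL by formalisation, printed: the rigidity branch of the spacetime positive mass theorem). -/
theorem stub_nonposMassKerrEnded : NonposMassKerrEnded := by
  sorry

/-- STUB S3a (M; provable now over `AFEndChartEmbedding` / `AFEndRestrict` / `ExactKerrEnd`). -/
theorem stub_chartKerrEnd : ChartKerrEnd := by
  sorry

/-- STUB S3b (L; provable now: the landed `junction` + `stub_breathing` pattern of `SwallowTheDatum.ParametricKerrBurial`,
upgraded by `TameFamilyOffCompact` / `AFEndRestrict` (tameness) and the marker derivative (immersion)). -/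
theorem stub_tameJunction : TameJunction := by
  sorry

/-! ## §2 The composition: the four stubs conclude the crux BY NAME (sorry-free) -/

/-- **`TameEscapeToKerrEnds` from the four stubs.**  Fix `X` and an exceptional admissible `d` (not Kerr-ended).
If the Kerr–Schild facts fail, every datum is vacuously Kerr-ended and nothing is exceptional.  Otherwise read off
the sole DR end `(e, M)` of `d`; `M ≤ 0` is impossible for an exceptional datum (S2); for `M > 0`, S1 gives the
receding matched-Kerr family, S3a makes its members Kerr-ended, and S3b turns it into the tame injective immersed
witness curve demanded by `IsTameChristodoulouGeneric … 1`. [folklore] -/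
theorem TameEscapeToKerrEnds_of :
    Registered.stub_matchedKerrGluingFamily → Registered.stub_nonposMassKerrEnded → Registered.stub_chartKerrEnd →
      Registered.stub_tameJunction →
      Summit.FinalStateConjecture.FinalStateConjecture.Theses.ExactKerrEnds.TameEscapeToKerrEnds := by
  intro h1 h2 h3a h3b X _ _ _ _ _ _
  -- the crux, with its let-bound legend `KerrEnded` zeta-reduced, is tame genericity of `HasExactKerrEnd`
  show InitialDataSet.IsTameChristodoulouGeneric (admissibleVacuumData X)
    (fun D : InitialDataSet (𝓡 3) X ↦ D.HasExactKerrEnd) 1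
  intro d hd
  obtain ⟨hd𝓓, hdexc⟩ := hd
  by_cases hKF : Kerr.Facts
  · obtain ⟨-, e, M, hsole, hDR⟩ := id hd𝓓
    by_cases hM : 0 < M
    · obtain ⟨Rstar, m, G, hRstar, hm, hmM, hG, hmem, hw⟩ := h1 X d hd𝓓 e M hsole hM hDR
      have hmem' : ∀ R : ℝ, Rstar < R →
          G R ∈ admissibleVacuumData X ∧ (∀ x ∉ e.far R, AgreeAt (G R) d x) ∧
            e.IsStronglyAsymptoticallyFlatDR (G R) (m R) ∧ (G R).HasExactKerrEnd := by
        intro R hR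
        obtain ⟨hadm, hagree, hdecay, hkerr⟩ := hmem R hR
        refine ⟨hadm, hagree, hdecay, h3a X e (G R) (4 * R) hsole ?_ hkerr⟩
        have hRpos : 0 < R := lt_trans e.R_pos (lt_trans hRstar hR)
        linarith
      obtain ⟨e', F, htame, himm, hF0, hinj, hadm, hK⟩ :=
        h3b X d e M Rstar m G hd𝓓 hsole hDR hRstar hm hmM hG hmem' hw
      exact ⟨e', F, htame, himm, hF0, hinj, hadm, fun c hc hmem_exc ↦ hmem_exc.2 (hK c hc)⟩
    · have hK : d.HasExactKerrEnd := h2 X d hd𝓓 e M hsole (not_lt.mp hM) hDR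
      exact (hdexc hK).elim
  · exact absurd (fun hinst ↦ absurd hinst hKF) hdexc

/-- **The skeleton instantiated**: the crux from the four registered stubs (sorries live only in `stub_*`). [folklore] -/
theorem TameEscapeToKerrEnds_skeleton :
    Summit.FinalStateConjecture.FinalStateConjecture.Theses.ExactKerrEnds.TameEscapeToKerrEnds :=
  TameEscapeToKerrEnds_of stub_matchedKerrGluingFamily stub_nonposMassKerrEnded stub_chartKerrEnd
    stub_tameJunction

end Summit.FinalStateConjecture.FinalStateConjecture.Cruxes.TameEscapeToKerrEnds.MatchedKerrSolutionMap

end
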